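import Literature.AnabelianGeometry.SemiGraphs.BTempQDPairHomBar
import HarnessLib

/-!
# Semi-graphs of anabelioids, Appendix, proof of Theorem A.4: the filtered system of 1-proper covers
# and `Hom^((B, Γ_B), (C, Γ_C)) := lim_→ Hom̄((B′, Γ_B′), (C, Γ_C))` (STATEMENTS-FIRST)

Mochizuki, *Semi-graphs of anabelioids*, Publ. RIMS **42** (2006) 221–322, Appendix, proof of
Theorem A.4, manuscript p. 84 (PRIMS p. 313 l. 23 – p. 314 l. 8)
[cite: MochizukiSemiAnbd2006, Thm A.4 proof p.84]: "every element of `Hom_{T_i}(B/Γ_B, C/Γ_C)`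
arises from some morphism of strongly connected QD-pairs `(B′, Γ_B′) → (C, Γ_C)` where
`(B′, Γ_B′) → (B, Γ_B)` is a 1-proper morphism of strongly connected QD-pairs [so we obtain a
morphism `B/Γ_B → C/Γ_C` by composing the induced morphism `B′/Γ_B′ → C/Γ_C` with the inverse of the
induced isomorphism `B′/Γ_B′ ⥲ B/Γ_B`]. Now one verifies easily that any two 1-proper morphisms of
strongly connected QD-pairs `(B″, Γ_B″) → (B, Γ_B)`, `(B‴, Γ_B‴) → (B, Γ_B)` fit into a commutative
diagram of 1-proper morphisms of strongly connected QD-pairs of `D_i` … Thus, we conclude that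
`Hom_{T_i}(B/Γ_B, C/Γ_C)` may be reconstructed as the following filtered inductive limit:
`Hom^((B, Γ_B), (C, Γ_C)) := lim_→ Hom̄((B′, Γ_B′), (C, Γ_C))` [i.e., over 1-proper morphisms of
strongly connected QD-pairs `(B′, Γ_B′) → (B, Γ_B)` and transition morphisms
`(B‴, Γ_B‴) → (B″, Γ_B″)` over `(B, Γ_B)`]. Moreover, one verifies immediately that this
reconstruction is compatible with composition of arrows".

Row **A4-lim (statements)** of `plan/L3/SUBDAG-SemiAnbd-Cor311.md` (holder abc-iut-w5-d129; L3-lead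
rulings μ3-1/ν3-1: the print route's deep step is typed STATEMENTS-FIRST tonight, proofs only where
cheap), over `QDPair.HomBar`/`homBarToHom` (`BTempQDPairHomBar.lean`, abc-iut-w4-d081) and the quotient
functor `q` (`BTempQDPairQuotientFunctor.lean`):

* in ANY category: `QDPair.OneProperCover P` (a 1-proper morphism `(B′, Γ_B′) → (B, Γ_B)` from a
  strongly connected QD-pair — the INDEX of the printed inductive limit), `OneProperCover.Transition`
  (1-proper morphisms over `(B, Γ_B)`), `QDPair.HomBar.precomp` (functoriality of `Hom̄` in the
  source), `QDPair.HomHat P C` (the inductive limit, as the quotient of `Σ_{B′} Hom̄((B′, Γ_B′), (C, Γ_C))`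
  by the relation generated by the transitions), `QDPair.homHatMk`;
* in `B^temp(Π)`: **`QDPair.homHatToHom : HomHat P C → (B/Γ_B ⟶ C/Γ_C)`**, `[(B′, f̄)] ↦
  (q(B′ → B))⁻¹ ≫ q(f)` (PROVED well defined: `q` inverts 1-proper morphisms,
  `isIso_orbitQuotientMap_of_isOneProper`, and is functorial), with `homHatToHom_mk`;
* the printed claims as NAMED STATEMENTS (open sub-nodes, not facts, never asserted):
  `QDPair.HomHatReconstructs P C` ("`Hom_{T_i}(B/Γ_B, C/Γ_C)` may be reconstructed as the filtered
  inductive limit `Hom^`": `homHatToHom P C` is a bijection — a predicate on the pair) and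
  `QDPair.OneProperCoversDirected` (the "commutative diagram of 1-proper morphisms" clause: the index
  is directed) and `QDPair.HomHatRealised` (every arrow of `T` is realised by some 1-proper cover)
  — the first is A4-lim proper; the other two are the two clauses of row A4-S read through `Hom^`
  (named here so that `HomHat` is documented as a FILTERED colimit and so that the reduction below
  can be stated; their proofs belong to that row's holder);
* PROVED reduction: `homHatToHom_injective_of_directed` (directedness + A4-H's injection ⇒
  `Hom^ → Hom_T` injective), `homHatToHom_surjective_of_realised`, **`homHatToHom_bijective_of`**
  (A4-lim's first clause ⇐ the two A4-S clauses).

Deliberately NOT typed here (recorded, A4-lim remainder, sized L): the composition law on `Hom^` and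
its compatibility ("compatible with composition of arrows"), the extension to weakly connected and
arbitrary pairs through connected components (p. 84 l. 9 – p. 85 l. 6), the category `P_i` and the
equivalence `P_i ⥲ T_i` (p. 85 ll. 7–12).  Elementary; nothing refers to the IUT corpus; no side is
taken on any disputed claim.
-/

open CategoryTheory

namespace Literature.AnabelianGeometry.SemiGraphs

universe v₁ u₁ u

namespace QDPair

/-! ### The index: 1-proper covers by strongly connected QD-pairs, and their transitions -/

section General

variable {Q : Type u₁} [Category.{v₁} Q]

/-- A **1-proper cover** of a QD-pair `(B, Γ_B)`: a 1-proper morphism `(B′, Γ_B′) → (B, Γ_B)` of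
QD-pairs with `(B′, Γ_B′)` strongly connected — the index of the printed inductive limit
"over 1-proper morphisms of strongly connected QD-pairs `(B′, Γ_B′) → (B, Γ_B)`".
[cite: MochizukiSemiAnbd2006, Thm A.4 proof p.84] -/
structure OneProperCover (P : QDPair Q) where
  /-- the covering QD-pair `(B′, Γ_B′)` -/
  src : QDPair Q
  /-- the 1-proper morphism `(B′, Γ_B′) → (B, Γ_B)` -/
  hom : src ⟶ P
  /-- `(B′, Γ_B′)` is strongly connected -/
  isStronglyConnected : src.IsStronglyConnected
  /-- the morphism is 1-proper (Def. A.3 (iv)) -/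
  isOneProper : Hom.IsOneProper hom

/-- A **transition** between 1-proper covers of `(B, Γ_B)`: a 1-proper morphism
`(B‴, Γ_B‴) → (B″, Γ_B″)` over `(B, Γ_B)` ("transition morphisms … over `(B, Γ_B)`"; the printed
diagram consists of 1-proper morphisms). [cite: MochizukiSemiAnbd2006, Thm A.4 proof p.84] -/
structure OneProperCover.Transition {P : QDPair Q} (c c' : OneProperCover P) where
  /-- the morphism `(B‴, Γ_B‴) → (B″, Γ_B″)` -/
  hom : c.src ⟶ c'.src
  /-- it lies over `(B, Γ_B)` -/
  w : hom ≫ c'.hom = c.hom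
  /-- it is 1-proper -/
  isOneProper : Hom.IsOneProper hom

/-- `Hom̄` is contravariant in the source: precomposition with a morphism of QD-pairs descends to
the classes modulo `Γ_C`. [cite: MochizukiSemiAnbd2006, Thm A.4 proof p.84] -/
def HomBar.precomp {P₁ P₁' P₂ : QDPair Q} (g : P₁' ⟶ P₁) : HomBar P₁ P₂ → HomBar P₁' P₂ :=
  Quotient.map' (fun f => g ≫ f) (by
    rintro f f' ⟨γ, hγ, h⟩
    refine ⟨γ, hγ, ?_⟩
    change g.hom ≫ f'.hom = (g.hom ≫ f.hom) ≫ γ.hom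
    rw [h, Category.assoc])

/-- Precomposition on classes. [cite: MochizukiSemiAnbd2006, Thm A.4 proof p.84] -/
@[simp] theorem HomBar.precomp_mk {P₁ P₁' P₂ : QDPair Q} (g : P₁' ⟶ P₁) (f : P₁ ⟶ P₂) :
    HomBar.precomp g (homBarMk f) = homBarMk (g ≫ f) := rfl

variable (P C : QDPair Q)

/-- The generating relation of the inductive limit: `(B″, x) ∼ (B‴, x ∘ t)` for a transition
`t : (B‴, Γ_B‴) → (B″, Γ_B″)` over `(B, Γ_B)`. [cite: MochizukiSemiAnbd2006, Thm A.4 proof p.84] -/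
def HomHatRel : (Σ c : OneProperCover P, HomBar c.src C) → (Σ c : OneProperCover P, HomBar c.src C) →
    Prop :=
  fun a b => ∃ t : OneProperCover.Transition b.1 a.1, b.2 = HomBar.precomp t.hom a.2

/-- **`Hom^((B, Γ_B), (C, Γ_C)) := lim_→ Hom̄((B′, Γ_B′), (C, Γ_C))`** — the inductive limit over the
1-proper covers of `(B, Γ_B)` by strongly connected QD-pairs and their transitions, as the quotient
of `Σ_{B′} Hom̄((B′, Γ_B′), (C, Γ_C))` by the equivalence relation generated by the transitions (for a
FILTERED index — `OneProperCoversDirected` — this is the usual description of the colimit of sets).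
[cite: MochizukiSemiAnbd2006, Thm A.4 proof p.84] -/
def HomHat : Type (max u₁ v₁) := Quot (HomHatRel P C)

variable {P C}

/-- The class `[(B′, f̄)] ∈ Hom^`. [cite: MochizukiSemiAnbd2006, Thm A.4 proof p.84] -/
def homHatMk (c : OneProperCover P) (x : HomBar c.src C) : HomHat P C := Quot.mk _ ⟨c, x⟩

/-- Every element of `Hom^` is a class `[(B′, f̄)]`. [cite: MochizukiSemiAnbd2006, Thm A.4 proof p.84] -/
theorem homHatMk_surjective : Function.Surjective (fun a : Σ c : OneProperCover P, HomBar c.src C =>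
    homHatMk a.1 a.2 : _ → HomHat P C) := by
  rintro ⟨⟨c, x⟩⟩
  exact ⟨⟨c, x⟩, rfl⟩

/-- A transition identifies `(B″, f̄)` with `(B‴, f̄ ∘ t)`. [cite: MochizukiSemiAnbd2006, Thm A.4 proof p.84] -/
theorem homHatMk_precomp {c c' : OneProperCover P} (t : OneProperCover.Transition c c')
    (x : HomBar c'.src C) : homHatMk c (HomBar.precomp t.hom x) = homHatMk c' x :=
  (Quot.sound (⟨t, rfl⟩ : HomHatRel P C ⟨c', x⟩ ⟨c, HomBar.precomp t.hom x⟩)).symm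

/-- **"any two 1-proper morphisms of strongly connected QD-pairs `(B″, Γ_B″) → (B, Γ_B)`,
`(B‴, Γ_B‴) → (B, Γ_B)` fit into a commutative diagram of 1-proper morphisms of strongly connected
QD-pairs"** — the index of `Hom^` is DIRECTED.  Named statement (the filteredness half of row A4-S of
the sub-DAG; open, never asserted; named here only to document `HomHat` as a filtered colimit).
[cite: MochizukiSemiAnbd2006, Thm A.4 proof p.84] -/
def OneProperCoversDirected (P : QDPair Q) : Prop :=
  ∀ c c' : OneProperCover P, ∃ (c'' : OneProperCover P),
    Nonempty (OneProperCover.Transition c'' c) ∧ Nonempty (OneProperCover.Transition c'' c')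

end General

/-! ### In `B^temp(Π)`: the comparison map `Hom^ → Hom_T(B/Γ_B, C/Γ_C)` -/

section BTemp

variable {G : Type u} [Group G] [TopologicalSpace G] [IsTopologicalGroup G]
  {P C : QDPair (BTemp G)}

/-- The arrow of `T = B^temp(Π)` attached to `(B′, f̄)`: `(q(B′ → B))⁻¹ ≫ q(f)` ("by composing the
induced morphism `B′/Γ_B′ → C/Γ_C` with the inverse of the induced isomorphism `B′/Γ_B′ ⥲ B/Γ_B`";
`q` inverts 1-proper morphisms). [cite: MochizukiSemiAnbd2006, Thm A.4 proof p.84] -/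
noncomputable def OneProperCover.toHom (c : OneProperCover P) (x : HomBar c.src C) :
    P.orbitQuotient ⟶ C.orbitQuotient :=
  haveI := isIso_orbitQuotientMap_of_isOneProper c.hom c.isOneProper
  inv (orbitQuotientMap c.hom) ≫ homBarToHom c.src C x

/-- On a class `f̄`: `(q(B′ → B))⁻¹ ≫ q(f)`. [cite: MochizukiSemiAnbd2006, Thm A.4 proof p.84] -/
theorem OneProperCover.toHom_mk (c : OneProperCover P) (f : c.src ⟶ C) :
    haveI := isIso_orbitQuotientMap_of_isOneProper c.hom c.isOneProper
    c.toHom (homBarMk f) = inv (orbitQuotientMap c.hom) ≫ orbitQuotientMap f := rfl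

/-- The attached arrow is unchanged along a transition (functoriality of `q`).
[cite: MochizukiSemiAnbd2006, Thm A.4 proof p.84] -/
theorem OneProperCover.toHom_precomp {c c' : OneProperCover P} (t : OneProperCover.Transition c c')
    (x : HomBar c'.src C) : c.toHom (HomBar.precomp t.hom x) = c'.toHom x := by
  induction x using Quotient.ind with
  | _ f =>
    haveI := isIso_orbitQuotientMap_of_isOneProper c.hom c.isOneProper
    haveI := isIso_orbitQuotientMap_of_isOneProper c'.hom c'.isOneProper
    haveI := isIso_orbitQuotientMap_of_isOneProper t.hom t.isOneProper
    change c.toHom (homBarMk (t.hom ≫ f)) = c'.toHom (homBarMk f)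
    rw [OneProperCover.toHom_mk, OneProperCover.toHom_mk]
    -- `q(t ≫ f) = q(t) ≫ q(f)` and `q(c.hom) = q(t ≫ c'.hom) = q(t) ≫ q(c'.hom)`
    have hf : orbitQuotientMap (t.hom ≫ f) = orbitQuotientMap t.hom ≫ orbitQuotientMap f :=
      (orbitQuotientFunctor (G := G)).map_comp t.hom f
    have hc : orbitQuotientMap c.hom = orbitQuotientMap t.hom ≫ orbitQuotientMap c'.hom := by
      have := (orbitQuotientFunctor (G := G)).map_comp t.hom c'.hom
      rw [t.w] at this
      exact this
    rw [hf, ← Category.assoc]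
    congr 1
    rw [IsIso.inv_comp_eq, hc, Category.assoc, IsIso.hom_inv_id, Category.comp_id]

/-- **The comparison map `Hom^((B, Γ_B), (C, Γ_C)) → Hom_T(B/Γ_B, C/Γ_C)`**, `[(B′, f̄)] ↦
(q(B′ → B))⁻¹ ≫ q(f)` (well defined by `toHom_precomp`).
[cite: MochizukiSemiAnbd2006, Thm A.4 proof p.84] -/
noncomputable def homHatToHom (P C : QDPair (BTemp G)) :
    HomHat P C → (P.orbitQuotient ⟶ C.orbitQuotient) :=
  Quot.lift (fun a => a.1.toHom a.2) (by
    rintro ⟨c', x⟩ ⟨c, y⟩ ⟨t, h⟩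
    dsimp only at t h ⊢
    rw [h]
    exact (OneProperCover.toHom_precomp t x).symm)

/-- The comparison map on a class. [cite: MochizukiSemiAnbd2006, Thm A.4 proof p.84] -/
@[simp] theorem homHatToHom_mk (c : OneProperCover P) (x : HomBar c.src C) :
    homHatToHom P C (homHatMk c x) = c.toHom x := rfl

/-- **"`Hom_{T_i}(B/Γ_B, C/Γ_C)` may be reconstructed as the filtered inductive limit
`Hom^((B, Γ_B), (C, Γ_C))`"** — the comparison map of `(B, Γ_B)`, `(C, Γ_C)` is a bijection (print:
for strongly connected pairs of a connected temperoid).  TYPED STATEMENT of row A4-lim as a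
predicate on the pair (not asserted for any pair here; `homHatReconstructs_of` below REDUCES it to
the two clauses of row A4-S). [cite: MochizukiSemiAnbd2006, Thm A.4 proof p.84] -/
def HomHatReconstructs (P C : QDPair (BTemp G)) : Prop :=
  Function.Bijective (homHatToHom P C)

/-- **The realisation clause** (the surjectivity half of the reconstruction; = the first clause of
row A4-S read through `Hom^`): every arrow `B/Γ_B → C/Γ_C` of `T` "arises from some morphism of
strongly connected QD-pairs `(B′, Γ_B′) → (C, Γ_C)` where `(B′, Γ_B′) → (B, Γ_B)` is a 1-proper
morphism", i.e. is `(q(B′ → B))⁻¹ ≫ q(f)` for some 1-proper cover `B′` and some `f`.  NAMED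
STATEMENT (open sub-node A4-S; never asserted). [cite: MochizukiSemiAnbd2006, Thm A.4 proof p.84] -/
def HomHatRealised (P C : QDPair (BTemp G)) : Prop :=
  ∀ u : P.orbitQuotient ⟶ C.orbitQuotient, ∃ (c : OneProperCover P) (f : c.src ⟶ C),
    c.toHom (homBarMk f) = u

/-- **Injectivity of `Hom^ → Hom_T` from directedness** (cheap half, PROVED): two classes with the
same attached arrow are refined to a common 1-proper cover (`OneProperCoversDirected`), where the
injection `Hom̄ ↪ Hom_T` for a strongly connected source (row A4-H, `homBarToHom_injective`)
identifies them. [cite: MochizukiSemiAnbd2006, Thm A.4 proof p.84] -/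
theorem homHatToHom_injective_of_directed (hdir : OneProperCoversDirected P) :
    Function.Injective (homHatToHom P C) := by
  rintro ⟨⟨c, x⟩⟩ ⟨⟨c', y⟩⟩ hxy
  change homHatToHom P C (homHatMk c x) = homHatToHom P C (homHatMk c' y) at hxy
  obtain ⟨c'', ⟨t⟩, ⟨t'⟩⟩ := hdir c c'
  change homHatMk c x = homHatMk c' y
  rw [← homHatMk_precomp t x, ← homHatMk_precomp t' y]
  rw [homHatToHom_mk, homHatToHom_mk, ← OneProperCover.toHom_precomp t x,
    ← OneProperCover.toHom_precomp t' y] at hxy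
  -- cancel the isomorphism `(q(B″ → B))⁻¹`
  haveI := isIso_orbitQuotientMap_of_isOneProper c''.hom c''.isOneProper
  have h : homBarToHom c''.src C (HomBar.precomp t.hom x) =
      homBarToHom c''.src C (HomBar.precomp t'.hom y) := by
    have := congrArg (fun φ => orbitQuotientMap c''.hom ≫ φ) hxy
    simpa only [OneProperCover.toHom, IsIso.hom_inv_id_assoc] using this
  rw [homBarToHom_injective C c''.isStronglyConnected h]

/-- **Surjectivity of `Hom^ → Hom_T` from the realisation clause** (formal).
[cite: MochizukiSemiAnbd2006, Thm A.4 proof p.84] -/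
theorem homHatToHom_surjective_of_realised (hreal : HomHatRealised P C) :
    Function.Surjective (homHatToHom P C) := by
  intro u
  obtain ⟨c, f, hf⟩ := hreal u
  exact ⟨homHatMk c (homBarMk f), hf⟩

/-- **The reconstruction `Hom^((B, Γ_B), (C, Γ_C)) ≅ Hom_T(B/Γ_B, C/Γ_C)` REDUCED to the two clauses of
row A4-S** (directedness of the 1-proper covers and realisation of every arrow): then the
comparison map is a bijection. [cite: MochizukiSemiAnbd2006, Thm A.4 proof p.84] -/
theorem homHatToHom_bijective_of (hdir : OneProperCoversDirected P) (hreal : HomHatRealised P C) :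
    Function.Bijective (homHatToHom P C) :=
  ⟨homHatToHom_injective_of_directed hdir, homHatToHom_surjective_of_realised hreal⟩

/-- Row A4-lim's first clause from row A4-S's two clauses. [cite: MochizukiSemiAnbd2006, Thm A.4 proof p.84] -/
theorem homHatReconstructs_of (hdir : OneProperCoversDirected P) (hreal : HomHatRealised P C) :
    HomHatReconstructs P C :=
  homHatToHom_bijective_of hdir hreal

end BTemp

end QDPair

end Literature.AnabelianGeometry.SemiGraphs
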